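import Summits.QuantumFields.QCD.Theorems.SmallFieldUltracontractivity.Negative.Tightness
import Literature.Probability.LatticeModels.TorusFourierProofs
import Literature.MathematicalPhysics.QuantumLattice.LatticeToriProofs

/-!
# Stub `stub_freeRowBounds` of line `point-centred-axial-parabolic`
(crux `Summit.QuantumFields.QCD.Theses.HeatSlicedQuarks.SmallFieldUltracontractivity`, item stmt-QuantumFields-8871)

Row summation of the pointwise parabolic decay of the free massive Wilson heat kernel
`K_σ = exp(-σ DᴴD)` (`D` the free Wilson–Dirac operator on the `L`-torus, `U ≡ 1`): from the
entrywise bounds `|K_σ(i, j)| ≤ C e^{-cσm²} (1+σ)/(1+σ+d²)³` and the nearest-neighbour column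
differences `≤ C e^{-cσm²} √(1+σ)/(1+σ+d²)³` (`d` the periodic `ℓ^∞` distance of the sites of
`i`, `j`) we derive, uniformly in `L`, the three summed row bounds consumed by the caloric
bootstrap: row `ℓ²` norm `≤ C'/(1+σ)`, row `ℓ¹` norm `≤ C' e^{-cσm²}`, summed nearest-neighbour
differences `≤ C' e^{-cσm²}/√(1+σ)`, with `C' = 2304 C`.

The only input is lattice geometry: radial summation on the `4`-torus against the sphere count
`#{dist = r} ≤ 8 (2r+1)³` (`LatticeToriProofs.sum_radial_le`) and the telescoping bound
`Σ_r (2r+1)/(A+r²)² ≤ 3/A` (`A ≥ 1`), whence `Σ_z (A + dist(x,z)²)^{-3} ≤ 192/A` and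
`Σ_z (A + dist(x,z)²)^{-6} ≤ 192/A⁴`. [folklore]
-/

noncomputable section

namespace Summit.QuantumFields.QCD.Cruxes.SmallFieldUltracontractivity.PointCentredAxialParabolic

open Literature.MathematicalPhysics.QuantumLattice Literature.MathematicalPhysics.QuantumFieldTheory
open Literature.Probability.LatticeModels (TorusSite torusChar)
open Summit.QuantumFields.QCD.Theorems.SmallFieldUltracontractivity.Negative
open scoped Matrix ComplexConjugate

/-! ### One-dimensional radial sums -/

/-- Telescoping step: for `A ≥ 1` and `r : ℕ`,
`(2r+1)/(A+r²)² ≤ 3 (1/(A+r²) - 1/(A+(r+1)²))`, because `A + (r+1)² ≤ 3 (A + r²)`. [folklore] -/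
theorem linear_div_sq_le_telescope {A : ℝ} (hA : 1 ≤ A) (r : ℕ) :
    (2 * (r : ℝ) + 1) / (A + (r : ℝ) ^ 2) ^ 2 ≤
      3 * (1 / (A + (r : ℝ) ^ 2) - 1 / (A + ((r + 1 : ℕ) : ℝ) ^ 2)) := by
  have hr : (0 : ℝ) ≤ r := Nat.cast_nonneg r
  have hrr : (r : ℝ) ≤ (r : ℝ) ^ 2 := by
    rcases Nat.eq_zero_or_pos r with h | h
    · simp [h]
    · have h1 : (1 : ℝ) ≤ r := by exact_mod_cast h
      nlinarith
  have hP : 0 < A + (r : ℝ) ^ 2 := by positivity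
  have hQ : 0 < A + ((r + 1 : ℕ) : ℝ) ^ 2 := by positivity
  have hQP : A + ((r : ℝ) + 1) ^ 2 ≤ 3 * (A + (r : ℝ) ^ 2) := by nlinarith
  rw [div_sub_div _ _ hP.ne' hQ.ne', one_mul, mul_one, mul_div_assoc',
    div_le_div_iff₀ (by positivity) (by positivity)]
  push_cast
  nlinarith [mul_nonneg (mul_nonneg (by positivity : (0 : ℝ) ≤ 2 * r + 1) hP.le) (sub_nonneg.2 hQP)]

/-- For `A ≥ 1`: `Σ_{r<N} (2r+1)/(A+r²)² ≤ 3/A`, uniformly in `N` (telescoping). [folklore] -/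
theorem sum_range_linear_div_sq_le {A : ℝ} (hA : 1 ≤ A) (N : ℕ) :
    ∑ r ∈ Finset.range N, (2 * (r : ℝ) + 1) / (A + (r : ℝ) ^ 2) ^ 2 ≤ 3 / A := by
  have hA0 : 0 < A := by linarith
  calc ∑ r ∈ Finset.range N, (2 * (r : ℝ) + 1) / (A + (r : ℝ) ^ 2) ^ 2
      ≤ ∑ r ∈ Finset.range N, 3 * (1 / (A + (r : ℝ) ^ 2) - 1 / (A + ((r + 1 : ℕ) : ℝ) ^ 2)) :=
        Finset.sum_le_sum fun r _ => linear_div_sq_le_telescope hA r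
    _ = 3 * (1 / (A + ((0 : ℕ) : ℝ) ^ 2) - 1 / (A + (N : ℝ) ^ 2)) := by
        rw [← Finset.mul_sum, Finset.sum_range_sub' (fun n : ℕ => 1 / (A + (n : ℝ) ^ 2)) N]
    _ ≤ 3 * (1 / A) := by
        have h0 : 0 ≤ 1 / (A + (N : ℝ) ^ 2) := by positivity
        have h1 : 1 / (A + ((0 : ℕ) : ℝ) ^ 2) = 1 / A := by simp
        rw [h1]
        linarith
    _ = 3 / A := by ring

/-! ### Radial sums on the four-dimensional torus -/

/-- Radial bound on `(ℤ/Lℤ)⁴`: for `A ≥ 1`, `Σ_z (A + dist(x,z)²)^{-3} ≤ 192/A`, uniformly in `L`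
(sphere count `≤ 8 (2r+1)³`, `(2r+1)² ≤ 8 (A + r²)`, and the telescoping bound). [folklore] -/
theorem sum_inv_cube_le {L : ℕ} [NeZero L] (x : TorusSite 4 L) {A : ℝ} (hA : 1 ≤ A) :
    ∑ z : TorusSite 4 L, 1 / (A + (torusDist x z : ℝ) ^ 2) ^ 3 ≤ 192 / A := by
  have hA0 : 0 < A := by linarith
  set F : ℕ → ℝ := fun r => 1 / (A + (r : ℝ) ^ 2) ^ 3 with hF
  have hF0 : ∀ r, 0 ≤ F r := fun r => by positivity
  have hrad := sum_radial_le (d := 4) F hF0 x (card_filter_torusDist_eq_le (by norm_num) x)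
    (fun u => torusDist_lt u x)
  calc ∑ z : TorusSite 4 L, 1 / (A + (torusDist x z : ℝ) ^ 2) ^ 3
      = ∑ z : TorusSite 4 L, F (torusDist z x) := by
        refine Finset.sum_congr rfl fun z _ => ?_
        rw [torusDist_comm' x z]
    _ ≤ ∑ r ∈ Finset.range L, ((4 * (2 * (2 * r + 1) ^ (4 - 1)) : ℕ) : ℝ) * F r := hrad
    _ ≤ ∑ r ∈ Finset.range L, 64 * ((2 * (r : ℝ) + 1) / (A + (r : ℝ) ^ 2) ^ 2) := by
        refine Finset.sum_le_sum fun r _ => ?_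
        have hr : (0 : ℝ) ≤ r := Nat.cast_nonneg r
        have hrr : (r : ℝ) ≤ (r : ℝ) ^ 2 := by
          rcases Nat.eq_zero_or_pos r with h | h
          · simp [h]
          · have h1 : (1 : ℝ) ≤ r := by exact_mod_cast h
            nlinarith
        have hP : 0 < A + (r : ℝ) ^ 2 := by positivity
        have hsq : (2 * (r : ℝ) + 1) ^ 2 ≤ 8 * (A + (r : ℝ) ^ 2) := by nlinarith
        have h8 : ((4 * (2 * (2 * r + 1) ^ (4 - 1)) : ℕ) : ℝ) = 8 * (2 * (r : ℝ) + 1) ^ 3 := by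
          norm_num
          ring
        rw [h8, hF]
        dsimp only
        rw [mul_one_div, mul_div_assoc', div_le_div_iff₀ (by positivity) (by positivity)]
        nlinarith [mul_nonneg (mul_nonneg (by positivity : (0 : ℝ) ≤ 2 * r + 1)
          (pow_nonneg hP.le 2)) (sub_nonneg.2 hsq)]
    _ = 64 * ∑ r ∈ Finset.range L, (2 * (r : ℝ) + 1) / (A + (r : ℝ) ^ 2) ^ 2 := by
        rw [Finset.mul_sum]
    _ ≤ 64 * (3 / A) := by gcongr; exact sum_range_linear_div_sq_le hA L
    _ = 192 / A := by ring

/-- Consequence: `Σ_z (A + dist(x,z)²)^{-6} ≤ 192/A⁴` for `A ≥ 1`, uniformly in `L`. [folklore] -/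
theorem sum_inv_sixth_le {L : ℕ} [NeZero L] (x : TorusSite 4 L) {A : ℝ} (hA : 1 ≤ A) :
    ∑ z : TorusSite 4 L, 1 / (A + (torusDist x z : ℝ) ^ 2) ^ 6 ≤ 192 / A ^ 4 := by
  have hA0 : 0 < A := by linarith
  calc ∑ z : TorusSite 4 L, 1 / (A + (torusDist x z : ℝ) ^ 2) ^ 6
      ≤ ∑ z : TorusSite 4 L, (1 / A ^ 3) * (1 / (A + (torusDist x z : ℝ) ^ 2) ^ 3) := by
        refine Finset.sum_le_sum fun z _ => ?_
        have hP : A ≤ A + (torusDist x z : ℝ) ^ 2 := le_add_of_nonneg_right (by positivity)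
        rw [one_div_mul_one_div]
        apply one_div_le_one_div_of_le (by positivity)
        calc A ^ 3 * (A + (torusDist x z : ℝ) ^ 2) ^ 3
            ≤ (A + (torusDist x z : ℝ) ^ 2) ^ 3 * (A + (torusDist x z : ℝ) ^ 2) ^ 3 := by gcongr
          _ = (A + (torusDist x z : ℝ) ^ 2) ^ 6 := by ring
    _ = (1 / A ^ 3) * ∑ z : TorusSite 4 L, 1 / (A + (torusDist x z : ℝ) ^ 2) ^ 3 := by
        rw [Finset.mul_sum]
    _ ≤ (1 / A ^ 3) * (192 / A) := by gcongr; exact sum_inv_cube_le x hA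
    _ = 192 / A ^ 4 := by
        field_simp

/-! ### Abstract row summation -/

/-- Splitting a sum over `TorusSite 4 L × Fin 3 × Fin 4` into site, colour and spin sums.
[folklore] -/
theorem sum_siteColourSpin {L : ℕ} [NeZero L] (φ : TorusSite 4 L × Fin 3 × Fin 4 → ℝ) :
    ∑ j, φ j = ∑ z : TorusSite 4 L, ∑ b : Fin 3, ∑ β : Fin 4, φ (z, b, β) := by
  rw [Fintype.sum_prod_type]
  exact Finset.sum_congr rfl fun z _ => Fintype.sum_prod_type _

/-- **Abstract row summation.** If a row `g` of a kernel on `TorusSite 4 L × Fin 3 × Fin 4`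
obeys the pointwise parabolic decay `|g(z,b,β)| ≤ C E (1+σ)/(1+σ+dist(x,z)²)³` and its
nearest-neighbour differences obey `≤ C E √(1+σ)/(1+σ+dist(x,z)²)³` (`σ ≥ 0`, `0 ≤ E ≤ 1`),
then `Σ |g|² ≤ (2304 C/(1+σ))²`, `Σ |g| ≤ 2304 C E` and the summed differences are
`≤ 2304 C E/√(1+σ)`. [folklore] -/
theorem row_bounds_of_decay {L : ℕ} [NeZero L] (x : TorusSite 4 L)
    (g : TorusSite 4 L × Fin 3 × Fin 4 → ℂ) {C E σ : ℝ} (hσ : 0 ≤ σ) (hE0 : 0 ≤ E)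
    (hE1 : E ≤ 1)
    (h1 : ∀ (z : TorusSite 4 L) (b : Fin 3) (β : Fin 4),
      ‖g (z, b, β)‖ ≤ C * E * (1 + σ) / (1 + σ + (torusDist x z : ℝ) ^ 2) ^ 3)
    (h2 : ∀ (z : TorusSite 4 L) (b : Fin 3) (β : Fin 4) (μ : Fin 4),
      ‖g (z, b, β) - g (Site.shift z μ, b, β)‖ ≤
        C * E * Real.sqrt (1 + σ) / (1 + σ + (torusDist x z : ℝ) ^ 2) ^ 3) :
    (∑ j, ‖g j‖ ^ 2 ≤ (2304 * C / (1 + σ)) ^ 2) ∧ (∑ j, ‖g j‖ ≤ 2304 * C * E) ∧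
      ∀ μ : Fin 4, ∑ z : TorusSite 4 L, ∑ b : Fin 3, ∑ β : Fin 4,
        ‖g (z, b, β) - g (Site.shift z μ, b, β)‖ ≤ 2304 * C * E / Real.sqrt (1 + σ) := by
  set A : ℝ := 1 + σ with hAdef
  have hA : 1 ≤ A := by rw [hAdef]; linarith
  have hA0 : 0 < A := by linarith
  have hS3 := sum_inv_cube_le x hA
  have hS6 := sum_inv_sixth_le x hA
  -- the sign of `C E`, from the pointwise bound at `z = x`
  have hCE : 0 ≤ C * E := by
    have h := (norm_nonneg _).trans (h1 x 0 0)
    have hP : 0 < (A + (torusDist x x : ℝ) ^ 2) ^ 3 := by positivity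
    rw [le_div_iff₀ hP, zero_mul] at h
    exact nonneg_of_mul_nonneg_left h hA0
  have htwelve : ∀ (z : TorusSite 4 L) (c : ℝ), ∑ _b : Fin 3, ∑ _β : Fin 4, c = 12 * c := by
    intro z c
    simp only [Finset.sum_const, Finset.card_univ, Fintype.card_fin, nsmul_eq_mul]
    push_cast
    ring
  refine ⟨?_, ?_, ?_⟩
  · -- (i) the row `ℓ²` norm
    rw [sum_siteColourSpin (fun j => ‖g j‖ ^ 2)]
    calc ∑ z : TorusSite 4 L, ∑ b : Fin 3, ∑ β : Fin 4, ‖g (z, b, β)‖ ^ 2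
        ≤ ∑ z : TorusSite 4 L, ∑ b : Fin 3, ∑ β : Fin 4,
            (C * E * A) ^ 2 * (1 / (A + (torusDist x z : ℝ) ^ 2) ^ 6) := by
          refine Finset.sum_le_sum fun z _ => Finset.sum_le_sum fun b _ =>
            Finset.sum_le_sum fun β _ => ?_
          have hP : 0 < A + (torusDist x z : ℝ) ^ 2 := by positivity
          calc ‖g (z, b, β)‖ ^ 2 ≤ (C * E * A / (A + (torusDist x z : ℝ) ^ 2) ^ 3) ^ 2 :=
                pow_le_pow_left₀ (norm_nonneg _) (h1 z b β) 2
            _ = (C * E * A) ^ 2 * (1 / (A + (torusDist x z : ℝ) ^ 2) ^ 6) := by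
                field_simp
      _ = 12 * (C * E * A) ^ 2 * ∑ z : TorusSite 4 L, 1 / (A + (torusDist x z : ℝ) ^ 2) ^ 6 := by
          rw [Finset.mul_sum]
          refine Finset.sum_congr rfl fun z _ => ?_
          rw [htwelve z]
          ring
      _ ≤ 12 * (C * E * A) ^ 2 * (192 / A ^ 4) := by gcongr
      _ = 2304 * (C ^ 2 * E ^ 2) / A ^ 2 := by
          field_simp
          ring
      _ ≤ 2304 * (C ^ 2 * 1) / A ^ 2 := by
          gcongr
          exact pow_le_one₀ hE0 hE1
      _ ≤ (2304 * C / A) ^ 2 := by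
          rw [div_pow]
          apply div_le_div_of_nonneg_right _ (by positivity)
          nlinarith [sq_nonneg C]
  · -- (ii) the row `ℓ¹` norm
    rw [sum_siteColourSpin (fun j => ‖g j‖)]
    calc ∑ z : TorusSite 4 L, ∑ b : Fin 3, ∑ β : Fin 4, ‖g (z, b, β)‖
        ≤ ∑ z : TorusSite 4 L, ∑ b : Fin 3, ∑ β : Fin 4,
            C * E * A * (1 / (A + (torusDist x z : ℝ) ^ 2) ^ 3) := by
          refine Finset.sum_le_sum fun z _ => Finset.sum_le_sum fun b _ =>
            Finset.sum_le_sum fun β _ => ?_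
          rw [mul_one_div]
          exact h1 z b β
      _ = 12 * (C * E * A) * ∑ z : TorusSite 4 L, 1 / (A + (torusDist x z : ℝ) ^ 2) ^ 3 := by
          rw [Finset.mul_sum]
          refine Finset.sum_congr rfl fun z _ => ?_
          rw [htwelve z]
          ring
      _ ≤ 12 * (C * E * A) * (192 / A) :=
          mul_le_mul_of_nonneg_left hS3 (mul_nonneg (by norm_num) (mul_nonneg hCE hA0.le))
      _ = 2304 * C * E := by
          field_simp
          ring
  · -- (iii) the summed nearest-neighbour differences
    intro μ
    calc ∑ z : TorusSite 4 L, ∑ b : Fin 3, ∑ β : Fin 4, ‖g (z, b, β) - g (Site.shift z μ, b, β)‖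
        ≤ ∑ z : TorusSite 4 L, ∑ b : Fin 3, ∑ β : Fin 4,
            C * E * Real.sqrt A * (1 / (A + (torusDist x z : ℝ) ^ 2) ^ 3) := by
          refine Finset.sum_le_sum fun z _ => Finset.sum_le_sum fun b _ =>
            Finset.sum_le_sum fun β _ => ?_
          rw [mul_one_div]
          exact h2 z b β μ
      _ = 12 * (C * E * Real.sqrt A) *
            ∑ z : TorusSite 4 L, 1 / (A + (torusDist x z : ℝ) ^ 2) ^ 3 := by
          rw [Finset.mul_sum]
          refine Finset.sum_congr rfl fun z _ => ?_
          rw [htwelve z]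
          ring
      _ ≤ 12 * (C * E * Real.sqrt A) * (192 / A) :=
          mul_le_mul_of_nonneg_left hS3
            (mul_nonneg (by norm_num) (mul_nonneg hCE (Real.sqrt_nonneg _)))
      _ = 2304 * C * E * (Real.sqrt A / A) := by ring
      _ = 2304 * C * E / Real.sqrt A := by rw [Real.sqrt_div_self', mul_one_div]

/-! ### The stub -/

/-- **Row bounds of the free massive Wilson heat kernel** (stub `stub_freeRowBounds` of line
`point-centred-axial-parabolic`). If the free kernel `K_σ = exp(-σ DᴴD)` (`U ≡ 1`, Wilson
parameter `1`, mass `m ∈ [-1/2, 1]`, `0 ≤ σ ≤ L²`) has the pointwise parabolic decay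
`|K_σ((x,a,α),(z,b,β))| ≤ C e^{-cσm²} (1+σ)/(1+σ+dist(x,z)²)³` with nearest-neighbour column
differences `≤ C e^{-cσm²} √(1+σ)/(1+σ+dist(x,z)²)³`, then, uniformly in `L`, every row has
`ℓ²` norm `≤ C'/(1+σ)`, `ℓ¹` norm `≤ C' e^{-cσm²}` and summed nearest-neighbour differences
`≤ C' e^{-cσm²}/√(1+σ)` (`C' = 2304 C`, same `c`): radial summation on the `4`-torus. [folklore] -/
theorem stub_freeRowBounds :
    (∃ C c : ℝ, 0 < c ∧ ∀ (L : ℕ) [NeZero L] (m : ℝ), m ∈ Set.Icc (-(1 / 2 : ℝ)) 1 →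
      ∀ σ : ℝ, 0 ≤ σ → σ ≤ (L : ℝ) ^ 2 →
      ∀ (x z : TorusSite 4 L) (a b : Fin 3) (α β : Fin 4),
        ‖(NormedSpace.exp (-(σ : ℂ) •
            ((wilsonDirac (fundamentalRep (Fin 3)) (freeCfg L) m 1)ᴴ *
              wilsonDirac (fundamentalRep (Fin 3)) (freeCfg L) m 1))) (x, a, α) (z, b, β)‖
          ≤ C * Real.exp (-(c * σ * m ^ 2)) * (1 + σ) / (1 + σ + (torusDist x z : ℝ) ^ 2) ^ 3 ∧
        ∀ μ : Fin 4,
          ‖(NormedSpace.exp (-(σ : ℂ) •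
              ((wilsonDirac (fundamentalRep (Fin 3)) (freeCfg L) m 1)ᴴ *
                wilsonDirac (fundamentalRep (Fin 3)) (freeCfg L) m 1))) (x, a, α) (z, b, β) -
            (NormedSpace.exp (-(σ : ℂ) •
              ((wilsonDirac (fundamentalRep (Fin 3)) (freeCfg L) m 1)ᴴ *
                wilsonDirac (fundamentalRep (Fin 3)) (freeCfg L) m 1))) (x, a, α) (Site.shift z μ, b, β)‖
          ≤ C * Real.exp (-(c * σ * m ^ 2)) * Real.sqrt (1 + σ) / (1 + σ + (torusDist x z : ℝ) ^ 2) ^ 3) →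
    (∃ C c : ℝ, 0 < c ∧ ∀ (L : ℕ) [NeZero L] (m : ℝ), m ∈ Set.Icc (-(1 / 2 : ℝ)) 1 →
      ∀ σ : ℝ, 0 ≤ σ → σ ≤ (L : ℝ) ^ 2 → ∀ (x : TorusSite 4 L) (a : Fin 3) (α : Fin 4),
        (∑ j, ‖(NormedSpace.exp (-(σ : ℂ) •
            ((wilsonDirac (fundamentalRep (Fin 3)) (freeCfg L) m 1)ᴴ *
              wilsonDirac (fundamentalRep (Fin 3)) (freeCfg L) m 1))) (x, a, α) j‖ ^ 2 ≤ (C / (1 + σ)) ^ 2) ∧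
        (∑ j, ‖(NormedSpace.exp (-(σ : ℂ) •
            ((wilsonDirac (fundamentalRep (Fin 3)) (freeCfg L) m 1)ᴴ *
              wilsonDirac (fundamentalRep (Fin 3)) (freeCfg L) m 1))) (x, a, α) j‖
          ≤ C * Real.exp (-(c * σ * m ^ 2))) ∧
        ∀ μ : Fin 4, ∑ z : TorusSite 4 L, ∑ b : Fin 3, ∑ β : Fin 4,
          ‖(NormedSpace.exp (-(σ : ℂ) •
              ((wilsonDirac (fundamentalRep (Fin 3)) (freeCfg L) m 1)ᴴ *
                wilsonDirac (fundamentalRep (Fin 3)) (freeCfg L) m 1))) (x, a, α) (z, b, β) -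
            (NormedSpace.exp (-(σ : ℂ) •
              ((wilsonDirac (fundamentalRep (Fin 3)) (freeCfg L) m 1)ᴴ *
                wilsonDirac (fundamentalRep (Fin 3)) (freeCfg L) m 1))) (x, a, α) (Site.shift z μ, b, β)‖
          ≤ C * Real.exp (-(c * σ * m ^ 2)) / Real.sqrt (1 + σ)) := by
  rintro ⟨C, c, hc, hH⟩
  refine ⟨2304 * C, c, hc, ?_⟩
  intro L _ m hm σ hσ0 hσL x a α
  have hE0 : 0 ≤ Real.exp (-(c * σ * m ^ 2)) := (Real.exp_pos _).le
  have hE1 : Real.exp (-(c * σ * m ^ 2)) ≤ 1 := by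
    rw [Real.exp_le_one_iff, neg_nonpos]
    exact mul_nonneg (mul_nonneg hc.le hσ0) (sq_nonneg m)
  exact row_bounds_of_decay x _ hσ0 hE0 hE1
    (fun z b β => (hH L m hm σ hσ0 hσL x z a b α β).1)
    (fun z b β μ => (hH L m hm σ hσ0 hσL x z a b α β).2 μ)

end Summit.QuantumFields.QCD.Cruxes.SmallFieldUltracontractivity.PointCentredAxialParabolic

end
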